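import Mathlib
import Summits.Ventures.HodgeRepro.Tier4.Common.AdelicRTF
import Summits.Ventures.HodgeRepro.Tier4.Common.MixedPlaneCusp
import Summits.Ventures.HodgeRepro.Tier4.Common.SettingOfData
import Summits.Ventures.HodgeRepro.Tier4.Line1.FiniteLevelIsolation
import Summits.Ventures.HodgeRepro.Tier4.Line4.OrbitalUnfold
import Summits.Ventures.HodgeRepro.Tier4.Line4.OrbitalOfOrbitalc
import Summits.Ventures.HodgeRepro.Tier4.Line4.OrbitalUnfoldCentral
import Summits.Ventures.HodgeRepro.Tier4.Line4.TorusProduct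
import Summits.Ventures.HodgeRepro.Tier4.Line4.TorusProductHaar
import Summits.Ventures.HodgeRepro.Tier4.Line4.InnerSplit
import Summits.Ventures.HodgeRepro.Tier4.Line4.CentreFinDomain
import Summits.Ventures.HodgeRepro.Tier4.Line4.ProdInt
import Summits.Ventures.HodgeRepro.Tier4.Line4.FiniteSum

/-!
# Tier4/Line4/HorbChain — C-L4-HORBCHAIN: the wall's `horb` binder from the factorisation chain

Blind re-derivation cell `pub-hodge-repro`, Tier 4 «prove the step» (README §9–§10), seat t4-L2-p1 (gen 3; L4 service
prover, lead (R-6′) S14693 / plan-4 g3 S14652).  Tree path `lean/Summits/Ventures/HodgeRepro/Tier4/Line4/HorbChain.lean`.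
Statement and proof = Part 7 of plan-4 g3's certificate proofs/t4-plan-4/work/HorbChain-Concat.lean c55298451d00d689 · 468
(S14616; crit-1 S14630 and crit-2 S14674 Entry 181 (ii) cleared the composition), BYTES VERBATIM, every stub of the
certificate now an imported tree theorem: CONV-Z `orbital_ne_zero_of_tsum_ne_zero` (OrbitalOfOrbitalc p693906), UNFOLD-Z
`tsum_orbit_eq_setIntegral_innerFull_of_regular` (OrbitalUnfoldCentral p694823), ZDOMAIN `isFundamentalDomain_prodDomain`
(CentreFinDomain p696615), PRODINT `setIntegral_chi_innerFull_prodDomain_eq` (ProdInt, t4-typer-1), FINSUM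
`re_setIntegral_chi_innerFin_pos` (FiniteSum, t4-L2-p3), INNERSPLIT's `innerInf` / `innerFin` (InnerSplit p696434) and
TORUSPROD's splitting (TorusProduct p695935 / TorusProductHaar p696122).  Mathlib-level; no literature.

`horb_of_chain`: for a product test function `F = F_∞ ⊗ F_f` with `F_f` real non-negative, a regular rational `γ₀`,
product Haar normalisations on both tori, a fundamental domain `DZ_f` of the image of `Z(k)` in `T_f`, the displayed
integrability / summability inputs of CONV-Z, UNFOLD-Z, PRODINT and FINSUM, and the ARCHIMEDEAN RESIDUAL `harch`, the
setting's orbital term at `orbitOf γ₀` is non-zero.  Every analytic hypothesis of the parts is carried as a binder;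
nothing is asserted.

Nothing here says anything about the status of the Hodge conjecture for CM abelian varieties, which is NOT proved
(HC_CM is NOT proved by anyone in this repository).
-/

set_option autoImplicit false
noncomputable section
namespace Summit.Ventures.HodgeRepro.Tier4.Line4
open Summit.Ventures.HodgeRepro.Tier4 Summit.Ventures.HodgeRepro.Tier4.Common
  Summit.Ventures.HodgeRepro.Tier4.Line1 MeasureTheory
open scoped ComplexConjugate Topology Pointwise NNReal

/-! ## `horb` from the chain (Part 7 of HorbChain-Concat c55298451d00d689, by name): CONV-Z ∘ UNFOLD-Z ∘ ZDOMAIN ∘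
PRODINT ∘ FINSUM ∘ the ARCH residual `harch` (displayed).  Every analytic hypothesis of the parts is carried as a binder;
nothing is asserted. -/

section Composition
variable {k : Type} [Field k] [NumberField k] (W : PlaneData k) [MeasurableSpace (GA W)] [BorelSpace (GA W)]
  (R : RTFData W) (μ : Measure (GA W)) [μ.IsHaarMeasure] [R.μT.IsHaarMeasure] [R.μT'.IsHaarMeasure]
  (DG : Set (GA W)) (fdG : IsFundamentalDomain (rationalPoints W) DG μ) (compG : IsCompact (closure DG))
  (compT : IsCompact (closure R.DT)) (compT' : IsCompact (closure R.DT'))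

/-- **`horb` by the chain**: for a product test function `F = F_∞ ⊗ F_f` with `F_f` real non-negative, a regular rational
`γ₀`, product Haar normalisations on both tori, a fundamental domain `DZ_f` of the image of `Z(k)` in `T_f`, the displayed
integrability / summability inputs of CONV-Z, UNFOLD-Z, PRODINT and FINSUM, and the ARCHIMEDEAN RESIDUAL `harch`, the
setting's orbital term at `orbitOf γ₀` is non-zero. -/
theorem horb_of_chain [MeasurableMul (torusT W)] [MeasurableMul (torusT' W)] (hR : R.IsHaar)
    (F Finf Ffin : GA W → ℂ) (hF : ∀ g, F g = Finf (GA.ofInfPart W g) * Ffin (GA.ofFinPart W g))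
    (γ₀ : rationalPoints W) (hreg : IsRegularRational W γ₀)
    (νinf : Measure (torusInf W)) [νinf.IsHaarMeasure] (νf : Measure (torusFin W)) [νf.IsHaarMeasure]
    (c : ℝ≥0) (hc : R.μT = c • Measure.map (torusSplit W).symm (νinf.prod νf)) (hc0 : c ≠ 0)
    (νinf' : Measure (torusInf' W)) [νinf'.IsHaarMeasure] (νf' : Measure (torusFin' W)) [νf'.IsHaarMeasure]
    (c' : ℝ≥0) (hc' : R.μT' = c' • Measure.map (torusSplit' W).symm (νinf'.prod νf')) (hc0' : c' ≠ 0)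
    (DZf : Set (torusFin W)) (hDZf : MeasurableSet DZf) (hfd : IsFundamentalDomain (centreFin W) DZf νf)
    -- CONV-Z (A1)–(A4)
    (hA1 : ∀ (γ : rationalPoints W) (t : torusT W),
      Integrable (innerFn W R F (γ : GA W) t) (R.μT'.restrict R.DT'))
    (hA2 : ∀ t : torusT W, Summable (fun γ : Set.range (orbitMap W γ₀) =>
      ∫ t' in R.DT', ‖innerFn W R F ((γ : rationalPoints W) : GA W) t t'‖ ∂(R.μT')))
    (hA3 : ∀ γ : rationalPoints W,
      Integrable (fun t : torusT W => R.chi t * innerInt W R F (γ : GA W) t) (R.μT.restrict R.DT))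
    (hA4 : Summable (fun γ : Set.range (orbitMap W γ₀) =>
      ∫ t in R.DT, ‖R.chi t * innerInt W R F ((γ : rationalPoints W) : GA W) t‖ ∂(R.μT)))
    -- UNFOLD-Z (B1)–(B4) + the orbit sum summable
    (hs : Summable (fun γ : Set.range (orbitMap W γ₀) => R.orbitalc ((γ : rationalPoints W) : GA W) F))
    (hB1 : IntegrableOn (fun t : torusT W => R.chi t * innerFull W R F (γ₀ : GA W) t) (prodDomain W DZf) R.μT)
    (hB2 : ∀ s : torusT W, Integrable (innerFn W R F (γ₀ : GA W) s) R.μT')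
    (hB3 : ∀ (δ : rationalOf W (torusT W)) (δ' : rationalOf W (torusT' W)),
      Integrable (fun t : torusT W =>
        R.chi t * innerInt W R F (((δ : torusT W) : GA W)⁻¹ * (γ₀ : GA W) * ((δ' : torusT' W) : GA W)) t)
        (R.μT.restrict R.DT))
    (hB4 : ∀ δ : rationalOf W (torusT W), Summable (fun δ' : rationalOf W (torusT' W) =>
      ∫ t in R.DT, ‖R.chi t * innerInt W R F (((δ : torusT W) : GA W)⁻¹ * (γ₀ : GA W) * ((δ' : torusT' W) : GA W)) t‖
        ∂(R.μT)))
    -- PRODINT integrability displays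
    (hA : ∀ t : torusT W, Integrable (fun a : torusInf' W => conj (R.chi' (a : torusT' W)) *
      Finf ((GA.ofInfPart W t)⁻¹ * GA.ofInfPart W (γ₀ : GA W) * ((a : torusT' W) : GA W))) νinf')
    (hB : ∀ t : torusT W, Integrable (fun b : torusFin' W => conj (R.chi' (b : torusT' W)) *
      Ffin ((GA.ofFinPart W t)⁻¹ * GA.ofFinPart W (γ₀ : GA W) * ((b : torusT' W) : GA W))) νf')
    (hIinf : Integrable (fun a : torusInf W => R.chi a * innerInf W R Finf (γ₀ : GA W) νinf' a) νinf)
    (hIfin : IntegrableOn (fun b : torusFin W => R.chi b * innerFin W R Ffin (γ₀ : GA W) νf' b) DZf νf)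
    -- FINSUM inputs (FINPOS′ + FINSUPP behind `hpos` / `hsupp`)
    (hreal : ∀ g, (Ffin g).im = 0) (hnonneg : ∀ g, 0 ≤ (Ffin g).re)
    (hpos : ∀ b ∈ DZf, ∀ b' : torusFin' W,
      Ffin ((((b : torusT W) : GA W))⁻¹ * GA.ofFinPart W (γ₀ : GA W) * ((b' : torusT' W) : GA W)) ≠ 0 →
      0 < (R.chi b * conj (R.chi' b')).re)
    (hint : IntegrableOn (fun p : torusFin W × torusFin' W => R.chi p.1 * conj (R.chi' p.2) *
      Ffin ((((p.1 : torusT W) : GA W))⁻¹ * GA.ofFinPart W (γ₀ : GA W) * ((p.2 : torusT' W) : GA W)))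
      (DZf ×ˢ Set.univ) (νf.prod νf'))
    (hsupp : 0 < (νf.restrict DZf).prod νf' {p : torusFin W × torusFin' W |
      Ffin ((((p.1 : torusT W) : GA W))⁻¹ * GA.ofFinPart W (γ₀ : GA W) * ((p.2 : torusT' W) : GA W)) ≠ 0})
    -- THE ARCHIMEDEAN RESIDUAL (displayed)
    (harch : (∫ a : torusInf W, R.chi a * innerInf W R Finf (γ₀ : GA W) νinf' a ∂νinf) ≠ 0) :
    (Setting.ofAdelicData W R μ DG fdG compG compT compT').orbital R.chi R.chi'
      ((Setting.ofAdelicData W R μ DG fdG compG compT compT').orbitOf γ₀) F ≠ 0 := by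
  apply orbital_ne_zero_of_tsum_ne_zero W R μ DG fdG compG compT compT' F γ₀ hA1 hA2 hA3 hA4
  rw [tsum_orbit_eq_setIntegral_innerFull_of_regular W R hR F γ₀ hreg (prodDomain W DZf)
    (isFundamentalDomain_prodDomain W νinf νf R.μT c hc DZf hfd) hs hB1 hB2 hB3 hB4]
  rw [setIntegral_chi_innerFull_prodDomain_eq W R νinf νf c hc νinf' νf' c' hc' F Finf Ffin hF (γ₀ : GA W) DZf hDZf
    hA hB hIinf hIfin]
  have hfin := re_setIntegral_chi_innerFin_pos W R νf νf' Ffin hreal hnonneg (γ₀ : GA W) DZf hDZf hpos hint hsupp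
  refine mul_ne_zero (mul_ne_zero (mul_ne_zero ?_ ?_) harch) ?_
  · exact_mod_cast hc0
  · exact_mod_cast hc0'
  · intro h0
    rw [h0] at hfin
    simp at hfin

end Composition

end Summit.Ventures.HodgeRepro.Tier4.Line4

end
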